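import Literature.Computability.Complexity.GnpSprinkling
import Literature.Computability.Complexity.GnpHarris
import HarnessLib

/-!
# The `k`-clique count of `G(n,p)` at the threshold is non-degenerate

For `p ∈ Θ(n^{-2/(k-1)})` the number `ω_k` of `k`-cliques of `G(n,p)` is asymptotically Poisson
with mean bounded away from `0` and `∞` (Bollobás; Janson–Łuczak–Ruciński, Thm. 3.19), so that
`Pr[ω_k = 0]` and `Pr[ω_k = 1]` stay bounded away from `0`. Rossman uses exactly these two
consequences in the proof of Theorem 2 of [Rossman2010] (Appendix B, proof of Lemma 17, p. 14:
"`Pr[ω_k(G) = 0] ⩾ Ω(1)` (since `p` is a threshold function)" and, through Lemma 23, conditioning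
on `{ω_k(G) = 1}`). This file PROVES them — without the Poisson limit — from Harris' inequality
(`GnpHarris.lean`) and first moments, in the finite-sum model of `G(n,p)`
(`gnpWeight`/`gnpProb`/`cliqueCount` of `Rossman2008.lean`, `RossmanMonotoneClique.lean`):

* `exp_le_gnpProb_cliqueFree` — `Pr[ω_k = 0] ≥ ∏_A (1 - p^{C(k,2)}) ≥ exp(-2 C(n,k) p^{C(k,2)})`;
* `gnpProb_cliqueCount_eq_one_eq_sum`, `le_gnpProb_uniqueClique`, `le_gnpProb_cliqueCount_eq_one`
  — `Pr[ω_k = 1] = Σ_A Pr[K_A ⊆ G, no other k-clique] ≥ C(n,k) p^{C(k,2)} exp(-2 M)` whenever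
  `Σ_{B ≠ A} p^{|E(K_B) ∖ E(K_A)|} ≤ M` (planting identity + Harris);
* `sum_erase_pow_inter_le` — at `p ≤ b n^{-2/(k-1)}` that sum is `≤ k 2^k b^{C(k,2)}`
  (the overlap computation `n^{k-j} p^{C(k,2)-C(j,2)} ≤ O(1)`, cf. App. B, proof of Lemma 23 (a));
* `eventually_le_gnpProb_cliqueFree`, `eventually_le_gnpProb_cliqueCount_eq_one` — the eventual
  forms for a density sequence squeezed between `a n^{-2/(k-1)}` and `b n^{-2/(k-1)}`;
* `tendsto_choose_mul_pow_sub_pow` — `C(n,k) (q^{C(k,2)} - p^{C(k,2)}) → 0` when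
  `p ≤ q ≤ p (1 + o(1))` at the threshold (the sprinkling error of `GnpSprinkling.lean`).

## References

* [Rossman2010] B. Rossman, The monotone complexity of k-clique on random graphs, FOCS 2010 /
  SIAM J. Comput. 43 (2014), Appendix B.
* S. Janson, T. Łuczak, A. Ruciński, Random Graphs (2000), Thm. 3.19 (Poisson limit at the
  threshold for strictly balanced graphs) — the classical statement these bounds replace.
-/

noncomputable section

namespace Literature.Computability.Complexity

open Finset Filter
open scoped _root_.Topology

variable {n : ℕ}

/-! ### Elementary facts on clique vectors -/

/-- In the pointwise order of Boolean vectors, a coordinate that is on stays on. [folklore] -/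
theorem apply_eq_true_of_le {ι : Type*} {x y : ι → Bool} (hxy : x ≤ y) {e : ι} (he : x e = true) :
    y e = true := by
  have h : x e ≤ y e := hxy e
  rw [he] at h
  exact top_le_iff.1 h

/-- Containment of a clique is an increasing event: `K_A ⊆ x`, `x ≤ y` give `K_A ⊆ y`. [folklore] -/
theorem forall_cliqueVec_of_le (A : Finset (Fin n)) {x y : (⊤ : SimpleGraph (Fin n)).edgeSet → Bool}
    (hxy : x ≤ y) (h : ∀ e, cliqueVec A e = true → x e = true) :
    ∀ e, cliqueVec A e = true → y e = true := fun e he => apply_eq_true_of_le hxy (h e he)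

/-- The edges of `K_B` that are also edges of `K_A` are the edges of `K_{A ∩ B}`. [folklore] -/
theorem cliqueVec_inter (A B : Finset (Fin n)) (e : (⊤ : SimpleGraph (Fin n)).edgeSet) :
    cliqueVec (A ∩ B) e = (cliqueVec B e && cliqueVec A e) := by
  simp only [cliqueVec]
  rw [← Bool.decide_and, decide_eq_decide]
  simp only [mem_inter]
  exact ⟨fun h => ⟨fun v hv => (h v hv).2, fun v hv => (h v hv).1⟩,
    fun h v hv => ⟨h.2 v hv, h.1 v hv⟩⟩

/-- `ω_k(x) = 1` iff some `k`-set spans a clique of `x` and it is the only one (unfolding of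
`cliqueCount`, independent of the decidability instances). [folklore] -/
theorem cliqueCount_eq_one_iff {k : ℕ} (x : (⊤ : SimpleGraph (Fin n)).edgeSet → Bool) :
    cliqueCount n k x = 1 ↔ ∃ A ∈ powersetCard k (univ : Finset (Fin n)),
      (∀ e, cliqueVec A e = true → x e = true) ∧
        ∀ B ∈ powersetCard k (univ : Finset (Fin n)), (∀ e, cliqueVec B e = true → x e = true) → B = A := by
  rw [cliqueCount, card_eq_one]
  constructor
  · rintro ⟨A, hA⟩
    have hmem := fun B => (Finset.ext_iff.1 hA B)
    have hAin := (hmem A).2 (mem_singleton_self A)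
    rw [mem_filter] at hAin
    refine ⟨A, hAin.1, hAin.2, fun B hB hsub => ?_⟩
    exact mem_singleton.1 ((hmem B).1 (mem_filter.2 ⟨hB, hsub⟩))
  · rintro ⟨A, hA, hsub, huniq⟩
    refine ⟨A, eq_singleton_iff_unique_mem.2 ⟨mem_filter.2 ⟨hA, hsub⟩, fun B hB => ?_⟩⟩
    rw [mem_filter] at hB
    exact huniq B hB.1 hB.2

/-- Two distinct `k`-sets: the second has a vertex outside the first. [folklore] -/
theorem exists_mem_notMem_of_ne {k : ℕ} {A B : Finset (Fin n)}
    (hA : A ∈ powersetCard k (univ : Finset (Fin n))) (hB : B ∈ powersetCard k (univ : Finset (Fin n)))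
    (hne : B ≠ A) : ∃ u ∈ B, u ∉ A := by
  by_contra hcon
  push Not at hcon
  have hsub : B ⊆ A := fun u hu => hcon u hu
  exact hne (eq_of_subset_of_card_le hsub
    (by rw [(mem_powersetCard.1 hA).2, (mem_powersetCard.1 hB).2]))

/-! ### `Pr[ω_k = 0]` is bounded below -/

/-- `Pr[K_A ⊈ G(n,p)] = 1 - p^{C(|A|,2)}`. [folklore] -/
theorem gnpProb_not_forall_cliqueVec (p : ℝ) (A : Finset (Fin n)) :
    gnpProb n p (univ.filter fun x : (⊤ : SimpleGraph (Fin n)).edgeSet → Bool =>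
        ¬ ∀ e, cliqueVec A e = true → x e = true) = 1 - p ^ (#A).choose 2 := by
  classical
  have h : (univ.filter fun x : (⊤ : SimpleGraph (Fin n)).edgeSet → Bool =>
      ¬ ∀ e, cliqueVec A e = true → x e = true) =
      (univ.filter fun x : (⊤ : SimpleGraph (Fin n)).edgeSet → Bool =>
        ∀ e, cliqueVec A e = true → x e = true)ᶜ := by
    ext x; simp
  rw [h, gnpProb_compl, gnpProb, sum_filter_cliqueVec_gnpWeight]

/-- **`Pr[ω_k(G(n,p)) = 0] ≥ exp(-2 C(n,k) p^{C(k,2)})`** for `p ∈ [0,1]` with `p^{C(k,2)} ≤ 1/2`: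
no `k`-clique is the intersection of the `C(n,k)` decreasing events `K_A ⊈ G`, so by Harris'
inequality `Pr[ω_k = 0] ≥ ∏_A (1 - p^{C(k,2)}) ≥ exp(-2 C(n,k) p^{C(k,2)})`. At the threshold
`C(n,k) p^{C(k,2)} = O(1)`, which is Rossman's "`Pr[ω_k(G) = 0] ⩾ Ω(1)` (since `p` is a threshold
function)". [cite: Rossman2010, App. B (proof of Lemma 17, p. 14)] -/
theorem exp_le_gnpProb_cliqueFree {p : ℝ} (hp0 : 0 ≤ p) (hp1 : p ≤ 1) (k : ℕ)
    (hpk : p ^ k.choose 2 ≤ 1 / 2) :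
    Real.exp (-(2 * ((n.choose k : ℝ) * p ^ k.choose 2))) ≤
      gnpProb n p (univ.filter fun x => cliqueCount n k x = 0) := by
  classical
  have hD : ∀ A ∈ powersetCard k (univ : Finset (Fin n)),
      ∀ x y : (⊤ : SimpleGraph (Fin n)).edgeSet → Bool, x ≤ y →
        ¬ (∀ e, cliqueVec A e = true → y e = true) → ¬ (∀ e, cliqueVec A e = true → x e = true) :=
    fun A _ x y hxy hy hx => hy (forall_cliqueVec_of_le A hxy hx)
  calc Real.exp (-(2 * ((n.choose k : ℝ) * p ^ k.choose 2)))
      = Real.exp (-(2 * ∑ A ∈ powersetCard k (univ : Finset (Fin n)), p ^ k.choose 2)) := by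
        rw [sum_const, card_powersetCard, card_univ, Fintype.card_fin, nsmul_eq_mul]
    _ ≤ ∏ A ∈ powersetCard k (univ : Finset (Fin n)), (1 - p ^ k.choose 2) :=
        exp_neg_two_mul_sum_le_prod_one_sub _ _ (fun _ _ => pow_nonneg hp0 _) (fun _ _ => hpk)
    _ = ∏ A ∈ powersetCard k (univ : Finset (Fin n)),
          gnpProb n p (univ.filter fun x : (⊤ : SimpleGraph (Fin n)).edgeSet → Bool =>
            ¬ ∀ e, cliqueVec A e = true → x e = true) :=
        prod_congr rfl fun A hA => by rw [gnpProb_not_forall_cliqueVec, (mem_powersetCard.1 hA).2]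
    _ ≤ gnpProb n p (univ.filter fun x => ∀ A ∈ powersetCard k (univ : Finset (Fin n)),
          ¬ ∀ e, cliqueVec A e = true → x e = true) := by
        convert prod_gnpProb_le_gnpProb_forall hp0 hp1 _
          (fun A x => ¬ ∀ e, cliqueVec A e = true → x e = true) hD using 3
    _ = gnpProb n p (univ.filter fun x => cliqueCount n k x = 0) := by
        congr 1
        ext x
        simp only [mem_filter, mem_univ, true_and, cliqueCount_eq_zero_iff_forall]

/-! ### `Pr[ω_k = 1]` is bounded below -/

/-- `{ω_k = 1}` is the disjoint union over `k`-sets `A` of the events "`K_A ⊆ G` and no other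
`k`-set spans a clique": `Pr[ω_k = 1] = Σ_A Pr[K_A ⊆ G ∧ ∀ B ≠ A, K_B ⊈ G]`. [folklore] -/
theorem gnpProb_cliqueCount_eq_one_eq_sum (p : ℝ) (k : ℕ) :
    gnpProb n p (univ.filter fun x => cliqueCount n k x = 1) =
      ∑ A ∈ powersetCard k (univ : Finset (Fin n)),
        gnpProb n p (univ.filter fun x : (⊤ : SimpleGraph (Fin n)).edgeSet → Bool =>
          (∀ e, cliqueVec A e = true → x e = true) ∧
            ∀ B ∈ powersetCard k (univ : Finset (Fin n)), B ≠ A →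
              ¬ ∀ e, cliqueVec B e = true → x e = true) := by
  classical
  -- pointwise: the indicators of the pieces sum to the indicator of `ω_k = 1`
  have hpt : ∀ x : (⊤ : SimpleGraph (Fin n)).edgeSet → Bool,
      ∑ A ∈ powersetCard k (univ : Finset (Fin n)),
        (if (∀ e, cliqueVec A e = true → x e = true) ∧
            ∀ B ∈ powersetCard k (univ : Finset (Fin n)), B ≠ A →
              ¬ ∀ e, cliqueVec B e = true → x e = true then (1 : ℝ) else 0) =
        if cliqueCount n k x = 1 then 1 else 0 := by
    intro x
    by_cases h1 : cliqueCount n k x = 1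
    · obtain ⟨A, hA, hsub, huniq⟩ := (cliqueCount_eq_one_iff x).1 h1
      rw [if_pos h1, sum_eq_single_of_mem A hA]
      · rw [if_pos ⟨hsub, fun B hB hne hB' => hne (huniq B hB hB')⟩]
      · intro B hB hne
        rw [if_neg]
        rintro ⟨hB', -⟩
        exact hne (huniq B hB hB')
    · rw [if_neg h1]
      refine sum_eq_zero fun A hA => ?_
      rw [if_neg]
      rintro ⟨hsub, huniq⟩
      refine h1 ((cliqueCount_eq_one_iff x).2 ⟨A, hA, hsub, fun B hB hB' => ?_⟩)
      by_contra hne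
      exact huniq B hB hne hB'
  rw [gnpProb_filter_eq_sum_mul_ite]
  simp_rw [gnpProb_filter_eq_sum_mul_ite]
  rw [sum_comm]
  refine sum_congr rfl fun x _ => ?_
  rw [← mul_sum, hpt x]

/-- The number of edges of `K_B` outside `K_A` is `C(|B|,2) - C(|A ∩ B|,2)`. [folklore] -/
theorem card_filter_cliqueVec_and_not (A B : Finset (Fin n)) :
    #(univ.filter fun e : (⊤ : SimpleGraph (Fin n)).edgeSet => cliqueVec B e = true ∧ cliqueVec A e = false) =
      (#B).choose 2 - (#(A ∩ B)).choose 2 := by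
  classical
  have h := card_filter_add_card_filter_not
    (s := univ.filter fun e : (⊤ : SimpleGraph (Fin n)).edgeSet => cliqueVec B e = true)
    (fun e => cliqueVec A e = true)
  rw [filter_filter, filter_filter, card_filter_cliqueVec] at h
  have h2 : #(univ.filter fun e : (⊤ : SimpleGraph (Fin n)).edgeSet =>
      cliqueVec B e = true ∧ cliqueVec A e = true) = (#(A ∩ B)).choose 2 := by
    rw [← card_filter_cliqueVec (A ∩ B)]
    congr 1
    refine filter_congr fun e _ => ?_
    rw [cliqueVec_inter, Bool.and_eq_true]
  have h3 : (univ.filter fun e : (⊤ : SimpleGraph (Fin n)).edgeSet =>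
      cliqueVec B e = true ∧ ¬ cliqueVec A e = true) =
      univ.filter fun e => cliqueVec B e = true ∧ cliqueVec A e = false := by
    refine filter_congr fun e _ => ?_
    simp
  rw [h2, h3] at h
  omega

/-- For distinct `k`-sets `A, B` with `k ≥ 2`, `K_B` has an edge outside `K_A`. [folklore] -/
theorem one_le_card_filter_cliqueVec_and_not {k : ℕ} (hk : 2 ≤ k) {A B : Finset (Fin n)}
    (hA : A ∈ powersetCard k (univ : Finset (Fin n))) (hB : B ∈ powersetCard k (univ : Finset (Fin n)))
    (hne : B ≠ A) :
    1 ≤ #(univ.filter fun e : (⊤ : SimpleGraph (Fin n)).edgeSet =>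
      cliqueVec B e = true ∧ cliqueVec A e = false) := by
  classical
  obtain ⟨u, huB, huA⟩ := exists_mem_notMem_of_ne hA hB hne
  have hcard : 1 < #B := by rw [(mem_powersetCard.1 hB).2]; omega
  obtain ⟨v, hvB, hvu⟩ := exists_mem_ne hcard u
  rw [Nat.one_le_iff_ne_zero, Ne, card_eq_zero, ← Ne, ← nonempty_iff_ne_empty]
  refine ⟨⟨s(u, v), by simpa using hvu.symm⟩, mem_filter.2 ⟨mem_univ _, ?_, ?_⟩⟩
  · simp only [cliqueVec, decide_eq_true_eq]
    intro w hw
    rcases Sym2.mem_iff.1 hw with rfl | rfl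
    · exact huB
    · exact hvB
  · simp only [cliqueVec, decide_eq_false_iff_not]
    intro h
    exact huA (h u (Sym2.mem_mk_left u v))

/-- `Pr[K_B ⊆ G ∪ K_A] = p^{C(|B|,2) - C(|A ∩ B|,2)}` (only the edges of `K_B` outside `K_A` have to
be present). [cite: Rossman2010, App. B (proof of Lemma 23 (a), p. 14)] -/
theorem gnpProb_forall_cliqueVec_sup (p : ℝ) (A B : Finset (Fin n)) :
    gnpProb n p (univ.filter fun x : (⊤ : SimpleGraph (Fin n)).edgeSet → Bool =>
        ∀ e, cliqueVec B e = true → (x ⊔ cliqueVec A) e = true) =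
      p ^ ((#B).choose 2 - (#(A ∩ B)).choose 2) := by
  classical
  rw [← card_filter_cliqueVec_and_not A B, ← sum_gnpWeight_filter_forall, gnpProb]
  refine sum_congr (filter_congr fun x _ => ?_) fun _ _ => rfl
  simp only [mem_filter, mem_univ, true_and, sup_apply_bool, Bool.or_eq_true]
  constructor
  · rintro h e ⟨hB, hA⟩
    rcases h e hB with hx | hA'
    · exact hx
    · rw [hA] at hA'; exact absurd hA' Bool.false_ne_true
  · intro h e hB
    by_cases hA : cliqueVec A e = true
    · exact Or.inr hA
    · exact Or.inl (h e ⟨hB, Bool.eq_false_iff.2 hA⟩)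

/-- **The piece of `{ω_k = 1}` at a fixed `k`-set `A`** (`k ≥ 2`, `0 ≤ p ≤ 1/2`):
`Pr[K_A ⊆ G ∧ ∀ B ≠ A, K_B ⊈ G] ≥ p^{C(k,2)} exp(-2 Σ_{B ≠ A} p^{C(k,2) - C(|A∩B|,2)})`. By the
planting identity the left side is `p^{C(k,2)} Pr[∀ B ≠ A, K_B ⊈ G ∪ K_A]`; the events
`K_B ⊈ G ∪ K_A` are decreasing, so Harris' inequality bounds the latter probability below by
`∏_{B ≠ A} (1 - p^{C(k,2)-C(|A∩B|,2)})` (cf. Rossman 2010, App. B, proof of Lemma 23 (a), where the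
same events and Harris' theorem control `Pr[ω_k(G ∪ K_A) ≥ 2 | ω_k(G) = 0]`).
[cite: Rossman2010, App. B (proof of Lemma 23, pp. 13–14)] -/
theorem le_gnpProb_uniqueClique {p : ℝ} (hp0 : 0 ≤ p) (hp : p ≤ 1 / 2) {k : ℕ} (hk : 2 ≤ k)
    {A : Finset (Fin n)} (hA : A ∈ powersetCard k (univ : Finset (Fin n))) :
    p ^ k.choose 2 * Real.exp (-(2 * ∑ B ∈ (powersetCard k (univ : Finset (Fin n))).erase A,
        p ^ (k.choose 2 - (#(A ∩ B)).choose 2))) ≤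
      gnpProb n p (univ.filter fun x : (⊤ : SimpleGraph (Fin n)).edgeSet → Bool =>
        (∀ e, cliqueVec A e = true → x e = true) ∧
          ∀ B ∈ powersetCard k (univ : Finset (Fin n)), B ≠ A →
            ¬ ∀ e, cliqueVec B e = true → x e = true) := by
  classical
  have hp1 : p ≤ 1 := hp.trans (by norm_num)
  have hAk : #A = k := (mem_powersetCard.1 hA).2
  set 𝒜 := powersetCard k (univ : Finset (Fin n)) with h𝒜
  -- the indicator of "no other clique"
  set G : ((⊤ : SimpleGraph (Fin n)).edgeSet → Bool) → ℝ := fun x =>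
    if ∀ B ∈ 𝒜, B ≠ A → ¬ ∀ e, cliqueVec B e = true → x e = true then 1 else 0 with hG
  -- Step 1: planting
  have step1 : gnpProb n p (univ.filter fun x : (⊤ : SimpleGraph (Fin n)).edgeSet → Bool =>
        (∀ e, cliqueVec A e = true → x e = true) ∧
          ∀ B ∈ 𝒜, B ≠ A → ¬ ∀ e, cliqueVec B e = true → x e = true) =
      p ^ k.choose 2 * ∑ x, gnpWeight n p x * G (x ⊔ cliqueVec A) := by
    have h1 : gnpProb n p (univ.filter fun x : (⊤ : SimpleGraph (Fin n)).edgeSet → Bool =>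
        (∀ e, cliqueVec A e = true → x e = true) ∧
          ∀ B ∈ 𝒜, B ≠ A → ¬ ∀ e, cliqueVec B e = true → x e = true) =
        ∑ x ∈ univ.filter (fun x : (⊤ : SimpleGraph (Fin n)).edgeSet → Bool =>
          ∀ e, cliqueVec A e = true → x e = true), gnpWeight n p x * G x := by
      rw [gnpProb, ← filter_filter, sum_filter, sum_filter, sum_filter]
      refine sum_congr rfl fun x _ => ?_
      by_cases hx : ∀ e, cliqueVec A e = true → x e = true
      · rw [if_pos hx]
        simp only [hG]
        split_ifs <;> simp
      · rw [if_neg hx, if_neg hx]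
    rw [h1, sum_filter_forall_gnpWeight_mul, edgeCount, card_filter_cliqueVec, hAk]
  -- Step 2: the planted sum is the probability of an intersection of decreasing events
  have step2 : ∑ x, gnpWeight n p x * G (x ⊔ cliqueVec A) =
      gnpProb n p (univ.filter fun x : (⊤ : SimpleGraph (Fin n)).edgeSet → Bool =>
        ∀ B ∈ 𝒜.erase A, ¬ ∀ e, cliqueVec B e = true → (x ⊔ cliqueVec A) e = true) := by
    rw [gnpProb_filter_eq_sum_mul_ite]
    refine sum_congr rfl fun x _ => ?_
    have hiff : (∀ B ∈ 𝒜, B ≠ A → ¬ ∀ e, cliqueVec B e = true → (x ⊔ cliqueVec A) e = true) ↔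
        ∀ B ∈ 𝒜.erase A, ¬ ∀ e, cliqueVec B e = true → (x ⊔ cliqueVec A) e = true := by
      simp only [mem_erase, ne_eq, and_imp]
      exact ⟨fun h B hne hB => h B hB hne, fun h B hB hne => h B hne hB⟩
    simp only [hG]
    by_cases hP : ∀ B ∈ 𝒜, B ≠ A → ¬ ∀ e, cliqueVec B e = true → (x ⊔ cliqueVec A) e = true
    · rw [if_pos hP, if_pos (hiff.1 hP)]
    · rw [if_neg hP, if_neg (mt hiff.2 hP)]
  -- Step 3: Harris
  have hD : ∀ B ∈ 𝒜.erase A, ∀ x y : (⊤ : SimpleGraph (Fin n)).edgeSet → Bool, x ≤ y →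
      ¬ (∀ e, cliqueVec B e = true → (y ⊔ cliqueVec A) e = true) →
        ¬ (∀ e, cliqueVec B e = true → (x ⊔ cliqueVec A) e = true) :=
    fun B _ x y hxy hy hx => hy (forall_cliqueVec_of_le B (sup_le_sup_right hxy _) hx)
  have step3 : ∏ B ∈ 𝒜.erase A, gnpProb n p (univ.filter fun x : (⊤ : SimpleGraph (Fin n)).edgeSet → Bool =>
        ¬ ∀ e, cliqueVec B e = true → (x ⊔ cliqueVec A) e = true) ≤
      gnpProb n p (univ.filter fun x : (⊤ : SimpleGraph (Fin n)).edgeSet → Bool =>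
        ∀ B ∈ 𝒜.erase A, ¬ ∀ e, cliqueVec B e = true → (x ⊔ cliqueVec A) e = true) := by
    convert prod_gnpProb_le_gnpProb_forall hp0 hp1 (𝒜.erase A)
      (fun B x => ¬ ∀ e, cliqueVec B e = true → (x ⊔ cliqueVec A) e = true) hD using 3
  -- Step 4: each factor is `1 - p^{C(k,2) - C(|A ∩ B|,2)} ≥ exp(-2 p^{…})`
  have step4 : ∀ B ∈ 𝒜.erase A,
      gnpProb n p (univ.filter fun x : (⊤ : SimpleGraph (Fin n)).edgeSet → Bool =>
        ¬ ∀ e, cliqueVec B e = true → (x ⊔ cliqueVec A) e = true) =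
        1 - p ^ (k.choose 2 - (#(A ∩ B)).choose 2) := by
    intro B hB
    have hBk : #B = k := (mem_powersetCard.1 (mem_erase.1 hB).2).2
    have h : (univ.filter fun x : (⊤ : SimpleGraph (Fin n)).edgeSet → Bool =>
        ¬ ∀ e, cliqueVec B e = true → (x ⊔ cliqueVec A) e = true) =
        (univ.filter fun x : (⊤ : SimpleGraph (Fin n)).edgeSet → Bool =>
          ∀ e, cliqueVec B e = true → (x ⊔ cliqueVec A) e = true)ᶜ := by
      ext x; simp
    rw [h, gnpProb_compl, gnpProb_forall_cliqueVec_sup, hBk]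
  have step5 : Real.exp (-(2 * ∑ B ∈ 𝒜.erase A, p ^ (k.choose 2 - (#(A ∩ B)).choose 2))) ≤
      ∏ B ∈ 𝒜.erase A, (1 - p ^ (k.choose 2 - (#(A ∩ B)).choose 2)) := by
    refine exp_neg_two_mul_sum_le_prod_one_sub _ _ (fun B _ => pow_nonneg hp0 _) fun B hB => ?_
    obtain ⟨hne, hB𝒜⟩ := mem_erase.1 hB
    have hBk : #B = k := (mem_powersetCard.1 hB𝒜).2
    have h1 : 1 ≤ k.choose 2 - (#(A ∩ B)).choose 2 := by
      have := one_le_card_filter_cliqueVec_and_not hk hA hB𝒜 hne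
      rwa [card_filter_cliqueVec_and_not, hBk] at this
    calc p ^ (k.choose 2 - (#(A ∩ B)).choose 2) ≤ p ^ 1 := pow_le_pow_of_le_one hp0 hp1 h1
      _ ≤ 1 / 2 := by rwa [pow_one]
  -- assemble
  rw [step1, step2]
  refine mul_le_mul_of_nonneg_left (step5.trans ?_) (pow_nonneg hp0 _)
  refine le_trans (le_of_eq ?_) step3
  exact prod_congr rfl fun B hB => (step4 B hB).symm

/-- **`Pr[ω_k(G(n,p)) = 1] ≥ C(n,k) p^{C(k,2)} exp(-2M)`** for `k ≥ 2`, `0 ≤ p ≤ 1/2`, whenever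
`Σ_{B ≠ A} p^{C(k,2) - C(|A∩B|,2)} ≤ M` for every `k`-set `A` (sum of `le_gnpProb_uniqueClique`
over `A`). At the threshold both `C(n,k) p^{C(k,2)}` and `M` are `Θ(1)`
(`sum_erase_pow_inter_le`), which gives the `Ω(1)` lower bound for `Pr[ω_k = 1]` implicit in
Rossman's conditioning on `{ω_k(G) = 1}` (Lemma 23 and the proof of Lemma 17).
[cite: Rossman2010, App. B (Lemma 23 and proof of Lemma 17, pp. 13–14)] -/
theorem le_gnpProb_cliqueCount_eq_one {p : ℝ} (hp0 : 0 ≤ p) (hp : p ≤ 1 / 2) {k : ℕ} (hk : 2 ≤ k)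
    {M : ℝ} (hM : ∀ A ∈ powersetCard k (univ : Finset (Fin n)),
      ∑ B ∈ (powersetCard k (univ : Finset (Fin n))).erase A,
        p ^ (k.choose 2 - (#(A ∩ B)).choose 2) ≤ M) :
    (n.choose k : ℝ) * p ^ k.choose 2 * Real.exp (-(2 * M)) ≤
      gnpProb n p (univ.filter fun x => cliqueCount n k x = 1) := by
  rw [gnpProb_cliqueCount_eq_one_eq_sum]
  calc (n.choose k : ℝ) * p ^ k.choose 2 * Real.exp (-(2 * M))
      = ∑ A ∈ powersetCard k (univ : Finset (Fin n)), p ^ k.choose 2 * Real.exp (-(2 * M)) := by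
        rw [sum_const, card_powersetCard, card_univ, Fintype.card_fin, nsmul_eq_mul, mul_assoc]
    _ ≤ ∑ A ∈ powersetCard k (univ : Finset (Fin n)), p ^ k.choose 2 *
          Real.exp (-(2 * ∑ B ∈ (powersetCard k (univ : Finset (Fin n))).erase A,
            p ^ (k.choose 2 - (#(A ∩ B)).choose 2))) :=
        sum_le_sum fun A hA => mul_le_mul_of_nonneg_left
          (Real.exp_le_exp.2 (by linarith [hM A hA])) (pow_nonneg hp0 _)
    _ ≤ _ := sum_le_sum fun A hA => le_gnpProb_uniqueClique hp0 hp hk hA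

/-! ### The overlap sum at the threshold -/

/-- The threshold arithmetic: for `j < k` and `N = C(k,2) - C(j,2)` one has
`n^{k-j} · (n^{-2/(k-1)})^N ≤ 1` (`n ≥ 1`), because `(k-j)(k-1) ≤ 2N = k(k-1) - j(j-1)`, i.e.
`0 ≤ j(k-j)` (Rossman 2010, App. B, proof of Lemma 23 (a):
"`n^{k-j-(2/(k-1))(C(k,2)-C(j,2))} ≤ O(n^{-1})`" for `2 ≤ j ≤ k-1`; here with the weak bound `≤ 1`
valid for all `0 ≤ j < k`). [cite: Rossman2010, App. B (proof of Lemma 23 (a), p. 14)] -/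
theorem pow_mul_rpow_threshold_le_one {k j : ℕ} (hk : 2 ≤ k) (hj : j < k) (hn : 1 ≤ n) :
    (n : ℝ) ^ (k - j) * ((n : ℝ) ^ (-(2 : ℝ) / ((k : ℝ) - 1))) ^ (k.choose 2 - j.choose 2) ≤ 1 := by
  have hn0 : (0 : ℝ) < n := by exact_mod_cast hn
  have hn1 : (1 : ℝ) ≤ n := by exact_mod_cast hn
  have hk1 : (0 : ℝ) < (k : ℝ) - 1 := by
    have : (2 : ℝ) ≤ k := by exact_mod_cast hk
    linarith
  have hjk : j ≤ k := hj.le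
  have hchoose : j.choose 2 ≤ k.choose 2 := Nat.choose_le_choose 2 hjk
  -- everything as a single real power of `n`
  rw [← Real.rpow_natCast, ← Real.rpow_mul_natCast hn0.le, ← Real.rpow_add hn0]
  refine Real.rpow_le_one_of_one_le_of_nonpos hn1 ?_
  rw [Nat.cast_sub hjk, Nat.cast_sub hchoose, Nat.cast_choose_two, Nat.cast_choose_two]
  have hj' : (j : ℝ) ≤ k := by exact_mod_cast hjk
  have hj0 : (0 : ℝ) ≤ j := Nat.cast_nonneg j
  rw [div_mul_eq_mul_div, ← sub_nonneg]
  have key : 0 ≤ (j : ℝ) * ((k : ℝ) - j) := mul_nonneg hj0 (by linarith)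
  rw [show (0 : ℝ) - (((k : ℝ) - j) + -2 * ((k : ℝ) * ((k : ℝ) - 1) / 2 - (j : ℝ) * ((j : ℝ) - 1) / 2) /
      ((k : ℝ) - 1)) = (j : ℝ) * ((k : ℝ) - j) / ((k : ℝ) - 1) by field_simp; ring]
  positivity

/-- **The overlap sum is bounded at the threshold.** For a `k`-set `A` (`k ≥ 2`), `n ≥ 1` and
`0 ≤ p ≤ b · n^{-2/(k-1)}` with `b ≥ 1`:
`Σ_{B ≠ A} p^{C(k,2) - C(|A∩B|,2)} ≤ k · 2^k · b^{C(k,2)}`. Grouping the `k`-sets `B` by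
`j = |A ∩ B| < k`, there are at most `C(k,j) C(n-k,k-j) ≤ 2^k n^{k-j}` of them and each contributes
`p^{C(k,2)-C(j,2)} ≤ b^{C(k,2)} n^{-(2/(k-1))(C(k,2)-C(j,2))}`, and `n^{k-j} n^{-(2/(k-1))(…)} ≤ 1`
(`pow_mul_rpow_threshold_le_one`) — the computation of Rossman 2010, App. B, proof of
Lemma 23 (a). [cite: Rossman2010, App. B (proof of Lemma 23 (a), p. 14)] -/
theorem sum_erase_pow_inter_le {k : ℕ} (hk : 2 ≤ k) (hn : 1 ≤ n) {p b : ℝ} (hp0 : 0 ≤ p)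
    (hb : 1 ≤ b) (hpb : p ≤ b * (n : ℝ) ^ (-(2 : ℝ) / ((k : ℝ) - 1)))
    {A : Finset (Fin n)} (hA : A ∈ powersetCard k (univ : Finset (Fin n))) :
    ∑ B ∈ (powersetCard k (univ : Finset (Fin n))).erase A, p ^ (k.choose 2 - (#(A ∩ B)).choose 2) ≤
      k * 2 ^ k * b ^ k.choose 2 := by
  classical
  set θ : ℝ := (n : ℝ) ^ (-(2 : ℝ) / ((k : ℝ) - 1)) with hθ
  set 𝒜 := powersetCard k (univ : Finset (Fin n)) with h𝒜
  have hAk : #A = k := (mem_powersetCard.1 hA).2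
  have hθ0 : 0 ≤ θ := Real.rpow_nonneg (Nat.cast_nonneg n) _
  have hb0 : 0 ≤ b := zero_le_one.trans hb
  -- the overlap of `B ≠ A` with `A` is a proper subset
  have hmaps : ∀ B ∈ 𝒜.erase A, #(A ∩ B) ∈ range k := by
    intro B hB
    obtain ⟨hne, hB𝒜⟩ := mem_erase.1 hB
    have hBk : #B = k := (mem_powersetCard.1 hB𝒜).2
    rw [mem_range, lt_iff_le_and_ne]
    refine ⟨hAk ▸ card_le_card inter_subset_left, fun heq => hne ?_⟩
    have h1 : A ∩ B = A := eq_of_subset_of_card_le inter_subset_left (by rw [heq, hAk])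
    have h2 : A ⊆ B := fun v hv => (mem_inter.1 (h1.symm ▸ hv)).2
    exact (eq_of_subset_of_card_le h2 (by rw [hAk, hBk])).symm
  -- size of the fibres
  have hfib : ∀ j ∈ range k, (#((𝒜.erase A).filter fun B => #(A ∩ B) = j) : ℝ) ≤ 2 ^ k * (n : ℝ) ^ (k - j) := by
    intro j hj
    have hinj : #((𝒜.erase A).filter fun B => #(A ∩ B) = j) ≤
        #(powersetCard j A ×ˢ powersetCard (k - j) Aᶜ) := by
      refine card_le_card_of_injOn (fun B => (A ∩ B, B \ A)) (fun B hB => ?_) (fun B₁ hB₁ B₂ hB₂ h => ?_)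
      · rw [mem_coe, mem_filter, mem_erase] at hB
        obtain ⟨⟨hne, hB𝒜⟩, hj'⟩ := hB
        have hBk : #B = k := (mem_powersetCard.1 hB𝒜).2
        simp only [mem_coe, mem_product, mem_powersetCard]
        refine ⟨⟨inter_subset_left, hj'⟩, fun v hv => mem_compl.2 (Finset.mem_sdiff.1 hv).2, ?_⟩
        have := card_sdiff_add_card_inter B A
        rw [inter_comm, hj', hBk] at this
        omega
      · simp only [Prod.mk.injEq] at h
        obtain ⟨h1, h2⟩ := h
        ext v
        by_cases hv : v ∈ A
        · have := Finset.ext_iff.1 h1 v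
          simp only [mem_inter, hv, true_and] at this
          exact this
        · have := Finset.ext_iff.1 h2 v
          simp only [Finset.mem_sdiff, hv, not_false_eq_true, and_true] at this
          exact this
    rw [card_product, card_powersetCard, card_powersetCard, card_compl, Fintype.card_fin, hAk] at hinj
    have h1 : k.choose j ≤ 2 ^ k := Nat.choose_le_two_pow k j
    have h2 : (n - k).choose (k - j) ≤ n ^ (k - j) :=
      (Nat.choose_le_pow _ _).trans (Nat.pow_le_pow_left (Nat.sub_le n k) _)
    calc (#((𝒜.erase A).filter fun B => #(A ∩ B) = j) : ℝ)
        ≤ ((k.choose j * (n - k).choose (k - j) : ℕ) : ℝ) := by exact_mod_cast hinj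
      _ ≤ ((2 ^ k * n ^ (k - j) : ℕ) : ℝ) := by exact_mod_cast Nat.mul_le_mul h1 h2
      _ = 2 ^ k * (n : ℝ) ^ (k - j) := by push_cast; ring
  -- size of the terms
  have hterm : ∀ j ∈ range k, p ^ (k.choose 2 - j.choose 2) ≤ b ^ k.choose 2 * θ ^ (k.choose 2 - j.choose 2) := by
    intro j hj
    have hN : k.choose 2 - j.choose 2 ≤ k.choose 2 := Nat.sub_le _ _
    calc p ^ (k.choose 2 - j.choose 2) ≤ (b * θ) ^ (k.choose 2 - j.choose 2) :=
          pow_le_pow_left₀ hp0 hpb _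
      _ = b ^ (k.choose 2 - j.choose 2) * θ ^ (k.choose 2 - j.choose 2) := mul_pow _ _ _
      _ ≤ b ^ k.choose 2 * θ ^ (k.choose 2 - j.choose 2) :=
          mul_le_mul_of_nonneg_right (pow_le_pow_right₀ hb hN) (pow_nonneg hθ0 _)
  -- sum fibrewise
  rw [← sum_fiberwise_of_maps_to hmaps]
  have hinner : ∀ j ∈ range k,
      ∑ B ∈ (𝒜.erase A).filter (fun B => #(A ∩ B) = j), p ^ (k.choose 2 - (#(A ∩ B)).choose 2) ≤
        2 ^ k * b ^ k.choose 2 := by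
    intro j hj
    have hjk : j < k := mem_range.1 hj
    calc ∑ B ∈ (𝒜.erase A).filter (fun B => #(A ∩ B) = j), p ^ (k.choose 2 - (#(A ∩ B)).choose 2)
        = ∑ B ∈ (𝒜.erase A).filter (fun B => #(A ∩ B) = j), p ^ (k.choose 2 - j.choose 2) :=
          sum_congr rfl fun B hB => by rw [(mem_filter.1 hB).2]
      _ = #((𝒜.erase A).filter fun B => #(A ∩ B) = j) * p ^ (k.choose 2 - j.choose 2) := by
          rw [sum_const, nsmul_eq_mul]
      _ ≤ (2 ^ k * (n : ℝ) ^ (k - j)) * (b ^ k.choose 2 * θ ^ (k.choose 2 - j.choose 2)) :=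
          mul_le_mul (hfib j hj) (hterm j hj) (pow_nonneg hp0 _) (by positivity)
      _ = 2 ^ k * b ^ k.choose 2 * ((n : ℝ) ^ (k - j) * θ ^ (k.choose 2 - j.choose 2)) := by ring
      _ ≤ 2 ^ k * b ^ k.choose 2 * 1 :=
          mul_le_mul_of_nonneg_left (pow_mul_rpow_threshold_le_one hk hjk hn) (by positivity)
      _ = 2 ^ k * b ^ k.choose 2 := mul_one _
  calc ∑ j ∈ range k, ∑ B ∈ (𝒜.erase A).filter (fun B => #(A ∩ B) = j),
          p ^ (k.choose 2 - (#(A ∩ B)).choose 2)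
      ≤ ∑ j ∈ range k, 2 ^ k * b ^ k.choose 2 := sum_le_sum hinner
    _ = k * 2 ^ k * b ^ k.choose 2 := by rw [sum_const, card_range, nsmul_eq_mul, mul_assoc]

/-! ### Eventual forms along a threshold density -/

/-- The threshold density tends to `0`: `n^{-2/(k-1)} → 0` for `k ≥ 2`. [folklore] -/
theorem tendsto_rpow_threshold {k : ℕ} (hk : 2 ≤ k) :
    Tendsto (fun n : ℕ => (n : ℝ) ^ (-(2 : ℝ) / ((k : ℝ) - 1))) atTop (𝓝 0) := by
  have hpos : 0 < (2 : ℝ) / ((k : ℝ) - 1) := by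
    have hk' : (2 : ℝ) ≤ k := by exact_mod_cast hk
    exact div_pos two_pos (by linarith)
  have h1 := (tendsto_rpow_neg_atTop hpos).comp tendsto_natCast_atTop_atTop
  refine h1.congr fun n => ?_
  simp only [Function.comp_apply, neg_div]

/-- `C(n,k) (b n^{-2/(k-1)})^{C(k,2)} ≤ b^{C(k,2)}` for `n ≥ 1`: the expected number of `k`-cliques
at density `b n^{-2/(k-1)}` is at most `b^{C(k,2)}` (`C(n,k) ≤ n^k` and
`(n^{-2/(k-1)})^{C(k,2)} = n^{-k}`). [folklore] -/
theorem choose_mul_threshold_pow_le {k : ℕ} (hk : 2 ≤ k) (hn : 1 ≤ n) {b : ℝ} (hb : 0 ≤ b) :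
    (n.choose k : ℝ) * (b * (n : ℝ) ^ (-(2 : ℝ) / ((k : ℝ) - 1))) ^ k.choose 2 ≤ b ^ k.choose 2 := by
  have hn0 : (0 : ℝ) < n := by exact_mod_cast hn
  have hk1 : (k : ℝ) - 1 ≠ 0 := by
    have : (2 : ℝ) ≤ k := by exact_mod_cast hk
    linarith
  have hθK : ((n : ℝ) ^ (-(2 : ℝ) / ((k : ℝ) - 1))) ^ k.choose 2 = (n : ℝ) ^ (-(k : ℝ)) := by
    rw [← Real.rpow_mul_natCast hn0.le, Nat.cast_choose_two]
    congr 1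
    field_simp
  have hchoose : (n.choose k : ℝ) ≤ (n : ℝ) ^ (k : ℝ) := by
    rw [Real.rpow_natCast]
    exact_mod_cast Nat.choose_le_pow n k
  rw [mul_pow, hθK, mul_left_comm]
  calc b ^ k.choose 2 * ((n.choose k : ℝ) * (n : ℝ) ^ (-(k : ℝ)))
      ≤ b ^ k.choose 2 * ((n : ℝ) ^ (k : ℝ) * (n : ℝ) ^ (-(k : ℝ))) :=
        mul_le_mul_of_nonneg_left (mul_le_mul_of_nonneg_right hchoose (Real.rpow_nonneg hn0.le _))
          (pow_nonneg hb _)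
    _ = b ^ k.choose 2 := by
        rw [← Real.rpow_add hn0, add_neg_cancel, Real.rpow_zero, mul_one]

/-- `C(n,k) (a n^{-2/(k-1)})^{C(k,2)} ≥ a^{C(k,2)} / (2^k k!)` for `n ≥ 2k`: the expected number of
`k`-cliques at density `a n^{-2/(k-1)}` is bounded below (`C(n,k) ≥ (n+1-k)^k / k! ≥ (n/2)^k / k!`).
[folklore] -/
theorem le_choose_mul_threshold_pow {k : ℕ} (hk : 2 ≤ k) (hn : 2 * k ≤ n) {a : ℝ} (ha : 0 ≤ a) :
    a ^ k.choose 2 / (2 ^ k * k.factorial) ≤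
      (n.choose k : ℝ) * (a * (n : ℝ) ^ (-(2 : ℝ) / ((k : ℝ) - 1))) ^ k.choose 2 := by
  have hn1 : 1 ≤ n := by omega
  have hn0 : (0 : ℝ) < n := by exact_mod_cast hn1
  have hk1 : (k : ℝ) - 1 ≠ 0 := by
    have : (2 : ℝ) ≤ k := by exact_mod_cast hk
    linarith
  have hθK : ((n : ℝ) ^ (-(2 : ℝ) / ((k : ℝ) - 1))) ^ k.choose 2 = ((n : ℝ) ^ k)⁻¹ := by
    rw [← Real.rpow_mul_natCast hn0.le, Nat.cast_choose_two, ← Real.rpow_natCast,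
      ← Real.rpow_neg hn0.le]
    congr 1
    field_simp
  -- `C(n,k) ≥ n^k / (2^k k!)`
  have hlow : (n : ℝ) ^ k / (2 ^ k * k.factorial) ≤ (n.choose k : ℝ) := by
    have h1 : ((n + 1 - k : ℕ) : ℝ) ^ k / k.factorial ≤ (n.choose k : ℝ) := Nat.pow_le_choose k n
    refine le_trans ?_ h1
    rw [← div_div, ← div_pow]
    refine div_le_div_of_nonneg_right (pow_le_pow_left₀ (by positivity) ?_ k) (by positivity)
    rw [Nat.cast_sub (by omega), Nat.cast_add, Nat.cast_one]
    have : (2 * k : ℝ) ≤ n := by exact_mod_cast hn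
    linarith
  rw [mul_pow, hθK]
  calc a ^ k.choose 2 / (2 ^ k * k.factorial)
      = ((n : ℝ) ^ k / (2 ^ k * k.factorial)) * (a ^ k.choose 2 * ((n : ℝ) ^ k)⁻¹) := by
        field_simp
    _ ≤ (n.choose k : ℝ) * (a ^ k.choose 2 * ((n : ℝ) ^ k)⁻¹) :=
        mul_le_mul_of_nonneg_right hlow (by positivity)

/-- **`Pr[ω_k(G(n,p_n)) = 0]` is eventually bounded below** along any density sequence
`0 ≤ p_n ≤ b n^{-2/(k-1)}` (`k ≥ 2`, `b ≥ 1`): eventually `Pr[ω_k = 0] ≥ exp(-2 b^{C(k,2)})`.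
This is "`Pr[ω_k(G) = 0] ⩾ Ω(1)` (since `p` is a threshold function)" in Rossman's proof of
Lemma 17. [cite: Rossman2010, App. B (proof of Lemma 17, p. 14)] -/
theorem eventually_le_gnpProb_cliqueFree {k : ℕ} (hk : 2 ≤ k) {p : ℕ → ℝ} {b : ℝ} (hb : 1 ≤ b)
    (hp : ∀ᶠ n : ℕ in atTop, 0 ≤ p n ∧ p n ≤ b * (n : ℝ) ^ (-(2 : ℝ) / ((k : ℝ) - 1))) :
    ∀ᶠ n : ℕ in atTop, Real.exp (-(2 * b ^ k.choose 2)) ≤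
      gnpProb n (p n) (univ.filter fun x => cliqueCount n k x = 0) := by
  have hb0 : 0 ≤ b := zero_le_one.trans hb
  have hsmall : ∀ᶠ n : ℕ in atTop, b * (n : ℝ) ^ (-(2 : ℝ) / ((k : ℝ) - 1)) ≤ 1 / 2 := by
    have h := (tendsto_rpow_threshold hk).const_mul b
    rw [mul_zero] at h
    exact h.eventually_le_const (by norm_num)
  have hK : 1 ≤ k.choose 2 := Nat.choose_pos hk
  filter_upwards [hp, hsmall, eventually_ge_atTop 1] with n hpn hsm hn1
  obtain ⟨hp0, hpb⟩ := hpn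
  have hphalf : p n ≤ 1 / 2 := hpb.trans hsm
  have hp1 : p n ≤ 1 := hphalf.trans (by norm_num)
  have hpK : p n ^ k.choose 2 ≤ 1 / 2 :=
    (pow_le_pow_of_le_one hp0 hp1 hK).trans (by rwa [pow_one])
  refine le_trans ?_ (exp_le_gnpProb_cliqueFree hp0 hp1 k hpK)
  rw [Real.exp_le_exp, neg_le_neg_iff]
  refine mul_le_mul_of_nonneg_left ?_ (by norm_num)
  calc (n.choose k : ℝ) * p n ^ k.choose 2
      ≤ (n.choose k : ℝ) * (b * (n : ℝ) ^ (-(2 : ℝ) / ((k : ℝ) - 1))) ^ k.choose 2 :=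
        mul_le_mul_of_nonneg_left (pow_le_pow_left₀ hp0 hpb _) (Nat.cast_nonneg _)
    _ ≤ b ^ k.choose 2 := choose_mul_threshold_pow_le hk hn1 hb0

/-- **`Pr[ω_k(G(n,p_n)) = 1]` is eventually bounded below** along any density sequence
`a n^{-2/(k-1)} ≤ p_n ≤ b n^{-2/(k-1)}` (`k ≥ 2`, `a > 0`, `b ≥ 1`): eventually
`Pr[ω_k = 1] ≥ (a^{C(k,2)} / (2^k k!)) · exp(-2 k 2^k b^{C(k,2)})`. This is the `Ω(1)` lower bound
that makes conditioning on `{ω_k(G) = 1}` (Rossman 2010, Lemma 23) meaningful in the proof of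
Lemma 17. [cite: Rossman2010, App. B (Lemma 23 and proof of Lemma 17, pp. 13–14)] -/
theorem eventually_le_gnpProb_cliqueCount_eq_one {k : ℕ} (hk : 2 ≤ k) {p : ℕ → ℝ} {a b : ℝ}
    (ha : 0 < a) (hb : 1 ≤ b)
    (hp : ∀ᶠ n : ℕ in atTop, a * (n : ℝ) ^ (-(2 : ℝ) / ((k : ℝ) - 1)) ≤ p n ∧
      p n ≤ b * (n : ℝ) ^ (-(2 : ℝ) / ((k : ℝ) - 1))) :
    ∀ᶠ n : ℕ in atTop, a ^ k.choose 2 / (2 ^ k * k.factorial) * Real.exp (-(2 * (k * 2 ^ k * b ^ k.choose 2))) ≤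
      gnpProb n (p n) (univ.filter fun x => cliqueCount n k x = 1) := by
  have hsmall : ∀ᶠ n : ℕ in atTop, b * (n : ℝ) ^ (-(2 : ℝ) / ((k : ℝ) - 1)) ≤ 1 / 2 := by
    have h := (tendsto_rpow_threshold hk).const_mul b
    rw [mul_zero] at h
    exact h.eventually_le_const (by norm_num)
  filter_upwards [hp, hsmall, eventually_ge_atTop (2 * k)] with n hpn hsm hn2
  obtain ⟨hpa, hpb⟩ := hpn
  have hn1 : 1 ≤ n := by omega
  have hθ0 : 0 ≤ (n : ℝ) ^ (-(2 : ℝ) / ((k : ℝ) - 1)) := Real.rpow_nonneg (Nat.cast_nonneg n) _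
  have hp0 : 0 ≤ p n := le_trans (mul_nonneg ha.le hθ0) hpa
  have hphalf : p n ≤ 1 / 2 := hpb.trans hsm
  have hM := fun A hA => sum_erase_pow_inter_le (n := n) hk hn1 hp0 hb hpb (A := A) hA
  refine le_trans ?_ (le_gnpProb_cliqueCount_eq_one hp0 hphalf hk hM)
  refine mul_le_mul_of_nonneg_right ?_ (Real.exp_pos _).le
  calc a ^ k.choose 2 / (2 ^ k * k.factorial)
      ≤ (n.choose k : ℝ) * (a * (n : ℝ) ^ (-(2 : ℝ) / ((k : ℝ) - 1))) ^ k.choose 2 :=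
        le_choose_mul_threshold_pow hk hn2 ha.le
    _ ≤ (n.choose k : ℝ) * p n ^ k.choose 2 :=
        mul_le_mul_of_nonneg_left (pow_le_pow_left₀ (mul_nonneg ha.le hθ0) hpa _) (Nat.cast_nonneg _)

/-- **The sprinkling error vanishes at the threshold.** If `0 ≤ p_n ≤ b n^{-2/(k-1)}` and
`p_n ≤ q_n ≤ p_n (1 + r_n)` with `r_n → 0`, `r_n ≥ 0`, then
`C(n,k) (q_n^{C(k,2)} - p_n^{C(k,2)}) → 0` (it is at most `b^{C(k,2)} ((1 + r_n)^{C(k,2)} - 1)`).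
With `q = p + p^{1+ε}` this is the error term of raising the density from `p` to `p + p^{1+ε}` in
Theorem 2 ("we can even replace `2p` with `p + p^{1+ε}`", Rossman 2010, §3).
[cite: Rossman2010, §3 (p. 4) and App. B (proof of Lemma 17, p. 14)] -/
theorem tendsto_choose_mul_pow_sub_pow {k : ℕ} (hk : 2 ≤ k) {p q r : ℕ → ℝ} {b : ℝ} (hb : 0 ≤ b)
    (hp : ∀ᶠ n : ℕ in atTop, 0 ≤ p n ∧ p n ≤ b * (n : ℝ) ^ (-(2 : ℝ) / ((k : ℝ) - 1)))
    (hq : ∀ᶠ n : ℕ in atTop, p n ≤ q n ∧ q n ≤ p n * (1 + r n))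
    (hr0 : ∀ᶠ n : ℕ in atTop, 0 ≤ r n) (hr : Tendsto r atTop (𝓝 0)) :
    Tendsto (fun n : ℕ => (n.choose k : ℝ) * (q n ^ k.choose 2 - p n ^ k.choose 2)) atTop (𝓝 0) := by
  -- the majorant `b^K ((1 + r)^K - 1) → 0`
  have hlim : Tendsto (fun n : ℕ => b ^ k.choose 2 * ((1 + r n) ^ k.choose 2 - 1)) atTop (𝓝 0) := by
    have h1 : Tendsto (fun n : ℕ => (1 + r n) ^ k.choose 2) atTop (𝓝 ((1 + 0) ^ k.choose 2)) :=
      (tendsto_const_nhds.add hr).pow _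
    have h2 := (h1.sub_const 1).const_mul (b ^ k.choose 2)
    simpa using h2
  refine squeeze_zero' ?_ ?_ hlim
  · filter_upwards [hp, hq] with n hpn hqn
    exact mul_nonneg (Nat.cast_nonneg _) (sub_nonneg.2 (pow_le_pow_left₀ hpn.1 hqn.1 _))
  · filter_upwards [hp, hq, hr0, eventually_ge_atTop 1] with n hpn hqn hrn hn1
    obtain ⟨hp0, hpb⟩ := hpn
    have h1 : q n ^ k.choose 2 ≤ (p n * (1 + r n)) ^ k.choose 2 :=
      pow_le_pow_left₀ (hp0.trans hqn.1) hqn.2 _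
    have h2 : (n.choose k : ℝ) * p n ^ k.choose 2 ≤ b ^ k.choose 2 :=
      (mul_le_mul_of_nonneg_left (pow_le_pow_left₀ hp0 hpb _) (Nat.cast_nonneg _)).trans
        (choose_mul_threshold_pow_le hk hn1 hb)
    have h3 : 0 ≤ (1 + r n) ^ k.choose 2 - 1 :=
      sub_nonneg.2 (one_le_pow₀ (by linarith))
    calc (n.choose k : ℝ) * (q n ^ k.choose 2 - p n ^ k.choose 2)
        ≤ (n.choose k : ℝ) * ((p n * (1 + r n)) ^ k.choose 2 - p n ^ k.choose 2) :=
          mul_le_mul_of_nonneg_left (sub_le_sub_right h1 _) (Nat.cast_nonneg _)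
      _ = (n.choose k : ℝ) * p n ^ k.choose 2 * ((1 + r n) ^ k.choose 2 - 1) := by
          rw [mul_pow]; ring
      _ ≤ b ^ k.choose 2 * ((1 + r n) ^ k.choose 2 - 1) := mul_le_mul_of_nonneg_right h2 h3

end Literature.Computability.Complexity

end
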